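import Summits.Ventures.YMGap.Thresholds.OneLinkRemainderGradientL2
import Summits.Ventures.YMGap.Thresholds.OneLinkSecondMoments
import HarnessLib

/-!
# Venture YMGap — the one-link modulus beyond first order, part 15: the SECOND-ORDER (level-two) one-link
# Kantorovich–Rubinstein modulus `K₂(N, R)` for every `SU(N)`, `N ≥ 3`, hypothesis-free

HONEST FRAMING: venture file of the cell `pub-ymgap` (QuantumFields programme), strong-coupling LATTICE bookkeeping for `SU(N)`
lattice Yang–Mills; nothing about the continuum or the mass gap in the Clay sense.  This file assembles the kernel pieces F1–F5 of
the cell note `HOME/p2/ONE-LINK-HIERARCHY.md` (§3–§4, CRUDE column of §5: first-order Schwinger–Dyson means, quadratic words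
bounded pointwise) into ONE explicit constant.

WHAT.  With `E = N²/(2(N²−4))`, `C = N²/(N²−1)`:
  `K₂(N,R) = C·( 1 + E R + 4C(E+¼)R² + (2(E+¼)/N)·R/√(½−R)
              + [ (5E+¼)R² + 2C(10E+½)R³ + ((10E+½)/N)·R²/√(½−R) ] / (½ − R) )`.
* `levelTwo_algebra`: the real-arithmetic assembly (covariance bound of `OneLinkLevelTwoCovariance` + the two `L²(ν_B)` gradient
  norms of `OneLinkRemainderGradientL2` + the second moments of `OneLinkSecondMoments` + `‖B‖_F ≤ √N‖B‖_op`);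
* `cov_linear_le_levelTwo_explicit`: `|Cov_{ν_B}(φ, N Re tr(·Δ))| ≤ K₂(N, ‖B‖_op)·L·‖Δ‖_F` for every bounded measurable
  `L`-Lipschitz `φ`, `‖B‖_op < 1/2`;
* `levelTwoBody_mono`: `K₂(N, ·)` is increasing on `[0, 1/2)`;
* `oneLinkKRModulus_levelTwo (hN : 3 ≤ N) (hR : R < 1/2) : OneLinkKRModulus N R (K₂(N,R))` (tilt interpolation, as in
  `oneLinkKRModulus_refined`).
Numbers (cell folder `work/hier/k2_lean.py`): `K₂(10, 0.2) = 2.13` vs `K_ref = 2.50`; through ds-1's star door the all-`N` rows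
move from `17/500, 7/200, 9/250` (`N ≥ 10, 20, 50`) to about `0.0365, 0.0375, 0.038` (next file).

References: cell notes `HOME/p2/ONE-LINK-HIERARCHY.md` §3–§5, `HOME/p2/hier/LEAN-SPEC-REMAINING.md` F6; Shen–Zhu–Zhu CMP 400 (2023) §4.1.
-/

noncomputable section

open scoped Matrix ComplexConjugate BigOperators ContDiff Matrix.Norms.Frobenius
open Matrix Complex Finset MeasureTheory ProbabilityTheory
open Literature.MathematicalPhysics.QuantumFieldTheory
open Literature.MathematicalPhysics.QuantumFieldTheory.SUNBakryEmery
open Literature.MathematicalPhysics.QuantumFieldTheory.Balaban1983to89.StrongCouplingDobrushinWindow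
open Literature.MathematicalPhysics.QuantumFieldTheory.Balaban1983to89.StrongCouplingKernelWindow

namespace Summit.Ventures.YMGap.OneLinkEigen

variable {N : ℕ}

/-! ### Two coefficient identities -/

/-- Coefficient identity for the `u + ψ₂` gradient norm. [folklore] -/
theorem levelTwo_idA (hN : (N : ℝ) ≠ 0) (E Dm r p : ℝ) :
    1 + 2 * (E / 2) * r + 2 * (E / N + 1 / (4 * (N : ℝ))) * (Dm * N * r ^ 2 + r / p) =
      1 + E * r + 2 * Dm * (E + 1 / 4) * r ^ 2 + 2 * ((E + 1 / 4) / N) * (r / p) := by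
  field_simp
  ring

/-- Coefficient identity for the cubic-remainder gradient norm. [folklore] -/
theorem levelTwo_idC (hN : (N : ℝ) ≠ 0) (E Dm r p : ℝ) :
    4 * (E / 2) * r ^ 2 + N * r ^ 2 * (2 * (E / 2) / N + 3 / 2 * (E / N + 1 / (4 * (N : ℝ))) + 1 / 2 * (E / N - 1 / (4 * (N : ℝ))))
      + r * (4 * (E / 2) / N + (E / N + 1 / (4 * (N : ℝ))) + 2 * (E / N)) * (Dm * N * r ^ 2 + r / p)
      + r * ((E / N + 1 / (4 * (N : ℝ))) + 4 * (E / N)) * (Dm * N * r ^ 2 + r / p) =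
      (5 * E + 1 / 4) * r ^ 2 + Dm * (10 * E + 1 / 2) * r ^ 3 + ((10 * E + 1 / 2) / N) * (r ^ 2 / p) := by
  field_simp
  ring

/-! ### Two bookkeeping lemmas -/

/-- Bookkeeping for the `u + ψ₂` gradient norm. [folklore] -/
theorem levelTwo_m1 {K nD nB Z₁ Z₂ GΨ W a : ℝ} (hK : 0 ≤ K) (hnD : 0 ≤ nD) (F1 : Z₁ ≤ W) (F2 : nB * Z₂ ≤ nD * W)
    (hΨ : GΨ ≤ a + K * nD * Z₁ + K * nB * Z₂) : GΨ ≤ a + 2 * K * nD * W := by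
  have t1 : K * nD * Z₁ ≤ K * nD * W := mul_le_mul_of_nonneg_left F1 (mul_nonneg hK hnD)
  have t2 : K * (nB * Z₂) ≤ K * (nD * W) := mul_le_mul_of_nonneg_left F2 hK
  have e2 : K * nB * Z₂ = K * (nB * Z₂) := by ring
  rw [e2] at hΨ
  linarith only [hΨ, t1, t2]

/-- Bookkeeping for the cubic-remainder gradient norm. [folklore] -/
theorem levelTwo_m2 {KW KT CC Nr S r nB nD Z₁ Z₂ Gc W : ℝ} (hNr : Nr ≠ 0) (hKW : 0 ≤ KW) (hKT : 0 ≤ KT) (hCC : 0 ≤ CC)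
    (hKm : 0 ≤ KT - CC) (hr : 0 ≤ r) (hnB : 0 ≤ nB) (hnD : 0 ≤ nD) (hW : 0 ≤ W) (hS : 0 ≤ S) (hNr0 : 0 ≤ Nr)
    (F1 : Z₁ ≤ W) (F2 : nB * Z₂ ≤ nD * W) (F3 : nB ^ 2 ≤ Nr * r ^ 2) (F4 : S * nB ≤ Nr * r)
    (hc : Gc ≤ (4 * KW * r ^ 2 * nD
          + nB ^ 2 * nD * (2 * KW / Nr + 3 / 2 * (KT + CC) + 1 / 2 * (KT - CC)))
        + nD * r * (4 * KW / Nr + (KT + CC) + 2 * KT) * Z₁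
        + nB * ((KT + CC) * r + 2 * KT * r + 2 * KT / Nr * S * nB) * Z₂) :
    Gc ≤ nD * (4 * KW * r ^ 2 + Nr * r ^ 2 * (2 * KW / Nr + 3 / 2 * (KT + CC) + 1 / 2 * (KT - CC))
      + r * (4 * KW / Nr + (KT + CC) + 2 * KT) * W + r * ((KT + CC) + 4 * KT) * W) := by
  have hσ : 0 ≤ 2 * KW / Nr + 3 / 2 * (KT + CC) + 1 / 2 * (KT - CC) := by positivity
  have u1 : nB ^ 2 * nD * (2 * KW / Nr + 3 / 2 * (KT + CC) + 1 / 2 * (KT - CC)) ≤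
      Nr * r ^ 2 * nD * (2 * KW / Nr + 3 / 2 * (KT + CC) + 1 / 2 * (KT - CC)) :=
    mul_le_mul_of_nonneg_right (mul_le_mul_of_nonneg_right F3 hnD) hσ
  have u2 : nD * r * (4 * KW / Nr + (KT + CC) + 2 * KT) * Z₁ ≤ nD * r * (4 * KW / Nr + (KT + CC) + 2 * KT) * W :=
    mul_le_mul_of_nonneg_left F1 (by positivity)
  have hβ0 : 0 ≤ (KT + CC) * r + 2 * KT * r + 2 * KT / Nr * S * nB := by positivity
  have u3a : nB * ((KT + CC) * r + 2 * KT * r + 2 * KT / Nr * S * nB) * Z₂ ≤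
      ((KT + CC) * r + 2 * KT * r + 2 * KT / Nr * S * nB) * (nD * W) := by
    have e : nB * ((KT + CC) * r + 2 * KT * r + 2 * KT / Nr * S * nB) * Z₂ =
        ((KT + CC) * r + 2 * KT * r + 2 * KT / Nr * S * nB) * (nB * Z₂) := by ring
    rw [e]; exact mul_le_mul_of_nonneg_left F2 hβ0
  have u3b : (KT + CC) * r + 2 * KT * r + 2 * KT / Nr * S * nB ≤ (KT + CC) * r + 2 * KT * r + 2 * KT * r := by
    have h1 : 2 * KT / Nr * (S * nB) ≤ 2 * KT / Nr * (Nr * r) := mul_le_mul_of_nonneg_left F4 (by positivity)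
    have e1 : 2 * KT / Nr * (Nr * r) = 2 * KT * r := by rw [div_mul_eq_mul_div, div_eq_iff hNr]; ring
    have e2 : 2 * KT / Nr * S * nB = 2 * KT / Nr * (S * nB) := by ring
    rw [e2]; linarith only [h1, e1]
  have u3 : nB * ((KT + CC) * r + 2 * KT * r + 2 * KT / Nr * S * nB) * Z₂ ≤
      ((KT + CC) * r + 2 * KT * r + 2 * KT * r) * (nD * W) :=
    u3a.trans (mul_le_mul_of_nonneg_right u3b (mul_nonneg hnD hW))
  simp only [div_eq_mul_inv] at hc u1 u2 u3 ⊢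
  linarith only [hc, u1, u2, u3]

/-! ### The real-arithmetic assembly -/

/-- **Assembly of the level-two bound (pure real arithmetic).**  If `V ≤ C L (GΨ + Gc/(½−r))` with the two gradient norms
bounded as in `OneLinkRemainderGradientL2`, the second moments as in `OneLinkSecondMoments` and `‖B‖_F ≤ √N r`, then
`V ≤ K₂(N, r) L ‖Δ‖_F`.  The coefficients are passed as variables with their defining equations. [folklore] -/
theorem levelTwo_algebra (hN : 3 ≤ N) {r nB nD L Z₁ Z₂ GΨ Gc V S C Dm KW KT CC E : ℝ}
    (hS : S = Real.sqrt N) (hCdef : C = (N : ℝ) ^ 2 / ((N : ℝ) ^ 2 - 1)) (hDm : 0 ≤ Dm)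
    (hKW : KW = (N : ℝ) ^ 2 / (4 * ((N : ℝ) ^ 2 - 4))) (hKT : KT = (N : ℝ) / (2 * ((N : ℝ) ^ 2 - 4)))
    (hCC : CC = 1 / (4 * (N : ℝ))) (hE : E = (N : ℝ) ^ 2 / (2 * ((N : ℝ) ^ 2 - 4)))
    (hr0 : 0 ≤ r) (hr : r < 1 / 2) (hnB0 : 0 ≤ nB) (hnD0 : 0 ≤ nD) (hL : 0 ≤ L) (hnB : nB ≤ S * r)
    (hZ1 : Z₁ ≤ Dm * (S * r * nB) + nB / Real.sqrt ((N : ℝ) * (1 / 2 - r)))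
    (hZ2 : Z₂ ≤ Dm * (S * r * nD) + nD / Real.sqrt ((N : ℝ) * (1 / 2 - r)))
    (hΨ : GΨ ≤ (nD + KW * (2 * r * nD)) + (KT + CC) * nD * Z₁ + (KT + CC) * nB * Z₂)
    (hc : Gc ≤ (4 * KW * r ^ 2 * nD
          + nB ^ 2 * nD * (2 * KW / N + 3 / 2 * (KT + CC) + 1 / 2 * (KT - CC)))
        + nD * r * (4 * KW / N + (KT + CC) + 2 * KT) * Z₁
        + nB * ((KT + CC) * r + 2 * KT * r + 2 * KT / N * S * nB) * Z₂)
    (hcov : V ≤ C * L * (GΨ + Gc / (1 / 2 - r))) :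
    V ≤ C * (1 + E * r + 2 * Dm * (E + 1 / 4) * r ^ 2
          + 2 * ((E + 1 / 4) / N) * (r / Real.sqrt (1 / 2 - r))
          + ((5 * E + 1 / 4) * r ^ 2 + Dm * (10 * E + 1 / 2) * r ^ 3
              + ((10 * E + 1 / 2) / N) * (r ^ 2 / Real.sqrt (1 / 2 - r))) / (1 / 2 - r)) * L * nD := by
  have hN0 : N ≠ 0 := by omega
  have h3 : (3 : ℝ) ≤ N := by exact_mod_cast hN
  have hN4 : (0 : ℝ) < (N : ℝ) ^ 2 - 4 := by nlinarith only [h3]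
  have hN1 : (0 : ℝ) < (N : ℝ) ^ 2 - 1 := by nlinarith only [h3]
  have hNpos : (0 : ℝ) < N := by linarith only [h3]
  have hNne : (N : ℝ) ≠ 0 := hNpos.ne'
  have hT : 0 < 1 / 2 - r := by linarith only [hr]
  have hSpos : 0 < S := by rw [hS]; exact Real.sqrt_pos.2 hNpos
  have hS2 : S * S = N := by rw [hS]; exact Real.mul_self_sqrt hNpos.le
  have hppos : 0 < Real.sqrt (1 / 2 - r) := Real.sqrt_pos.2 hT
  have hqSp : Real.sqrt ((N : ℝ) * (1 / 2 - r)) = S * Real.sqrt (1 / 2 - r) := by rw [hS]; exact Real.sqrt_mul hNpos.le _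
  have hqpos : 0 < Real.sqrt ((N : ℝ) * (1 / 2 - r)) := by rw [hqSp]; exact mul_pos hSpos hppos
  have hC0 : 0 ≤ C := by rw [hCdef]; exact div_nonneg (by positivity) hN1.le
  have hKW0 : 0 ≤ KW := by rw [hKW]; positivity
  have hKT0 : 0 ≤ KT := by rw [hKT]; positivity
  have hCC0 : 0 ≤ CC := by rw [hCC]; positivity
  have hE0 : 0 ≤ E := by rw [hE]; positivity
  have hcκ : CC ≤ KT := by
    rw [hCC, hKT, div_le_div_iff₀ (by positivity) (by positivity)]
    nlinarith only [h3]
  have hK1 : 0 ≤ KT + CC := add_nonneg hKT0 hCC0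
  have hKm : 0 ≤ KT - CC := by linarith only [hcκ]
  have eKW : KW = E / 2 := by rw [hKW, hE]; field_simp; try ring
  have eKT : KT = E / N := by rw [hKT, hE]; field_simp; try ring
  -- the `S`-free second-moment scale
  have hW0 : 0 ≤ Dm * N * r ^ 2 + r / Real.sqrt (1 / 2 - r) := by positivity
  have F0 : nB * (Dm * (S * r) + 1 / Real.sqrt ((N : ℝ) * (1 / 2 - r))) ≤ Dm * N * r ^ 2 + r / Real.sqrt (1 / 2 - r) := by
    have a1 : nB * (Dm * (S * r)) ≤ Dm * N * r ^ 2 := by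
      calc nB * (Dm * (S * r)) ≤ (S * r) * (Dm * (S * r)) := mul_le_mul_of_nonneg_right hnB (by positivity)
        _ = Dm * r ^ 2 * (S * S) := by ring
        _ = Dm * N * r ^ 2 := by rw [hS2]; ring
    have a2 : nB * (1 / Real.sqrt ((N : ℝ) * (1 / 2 - r))) ≤ r / Real.sqrt (1 / 2 - r) := by
      calc nB * (1 / Real.sqrt ((N : ℝ) * (1 / 2 - r))) ≤ (S * r) * (1 / Real.sqrt ((N : ℝ) * (1 / 2 - r))) :=
            mul_le_mul_of_nonneg_right hnB (by positivity)
        _ = r / Real.sqrt (1 / 2 - r) := by rw [hqSp]; field_simp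
    rw [mul_add]; exact add_le_add a1 a2
  have F1 : Z₁ ≤ Dm * N * r ^ 2 + r / Real.sqrt (1 / 2 - r) := by
    refine hZ1.trans ?_
    have e : Dm * (S * r * nB) + nB / Real.sqrt ((N : ℝ) * (1 / 2 - r)) =
        nB * (Dm * (S * r) + 1 / Real.sqrt ((N : ℝ) * (1 / 2 - r))) := by ring
    rw [e]; exact F0
  have F2 : nB * Z₂ ≤ nD * (Dm * N * r ^ 2 + r / Real.sqrt (1 / 2 - r)) := by
    have e : Dm * (S * r * nD) + nD / Real.sqrt ((N : ℝ) * (1 / 2 - r)) =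
        nD * (Dm * (S * r) + 1 / Real.sqrt ((N : ℝ) * (1 / 2 - r))) := by ring
    have h1 : nB * Z₂ ≤ nB * (nD * (Dm * (S * r) + 1 / Real.sqrt ((N : ℝ) * (1 / 2 - r)))) := by
      refine mul_le_mul_of_nonneg_left ?_ hnB0; rw [← e]; exact hZ2
    have h2 : nB * (nD * (Dm * (S * r) + 1 / Real.sqrt ((N : ℝ) * (1 / 2 - r)))) =
        nD * (nB * (Dm * (S * r) + 1 / Real.sqrt ((N : ℝ) * (1 / 2 - r)))) := by ring
    rw [h2] at h1
    exact h1.trans (mul_le_mul_of_nonneg_left F0 hnD0)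
  have F3 : nB ^ 2 ≤ N * r ^ 2 := by
    calc nB ^ 2 ≤ (S * r) ^ 2 := pow_le_pow_left₀ hnB0 hnB 2
      _ = (S * S) * r ^ 2 := by ring
      _ = N * r ^ 2 := by rw [hS2]
  have F4 : S * nB ≤ N * r := by
    calc S * nB ≤ S * (S * r) := mul_le_mul_of_nonneg_left hnB hSpos.le
      _ = (S * S) * r := by ring
      _ = N * r := by rw [hS2]
  -- (i) the `u + ψ₂` gradient norm, (ii) the cubic-remainder gradient norm
  have m1' := levelTwo_m1 hK1 hnD0 F1 F2 hΨ
  have m1 : GΨ ≤ nD * (1 + 2 * KW * r + 2 * (KT + CC) * (Dm * N * r ^ 2 + r / Real.sqrt (1 / 2 - r))) :=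
    m1'.trans (le_of_eq (by ring))
  have m2 := levelTwo_m2 hNne hKW0 hKT0 hCC0 hKm hr0 hnB0 hnD0 hW0 hSpos.le hNpos.le F1 F2 F3 F4 hc
  -- (iii) combine
  have hsum : GΨ + Gc / (1 / 2 - r) ≤ nD * (1 + 2 * KW * r + 2 * (KT + CC) * (Dm * N * r ^ 2 + r / Real.sqrt (1 / 2 - r)))
      + nD * (4 * KW * r ^ 2 + N * r ^ 2 * (2 * KW / N + 3 / 2 * (KT + CC) + 1 / 2 * (KT - CC))
        + r * (4 * KW / N + (KT + CC) + 2 * KT) * (Dm * N * r ^ 2 + r / Real.sqrt (1 / 2 - r))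
        + r * ((KT + CC) + 4 * KT) * (Dm * N * r ^ 2 + r / Real.sqrt (1 / 2 - r))) / (1 / 2 - r) :=
    add_le_add m1 (div_le_div_of_nonneg_right m2 hT.le)
  have hCL : 0 ≤ C * L := mul_nonneg hC0 hL
  have hmain := hcov.trans (mul_le_mul_of_nonneg_left hsum hCL)
  -- (iv) rewrite the coefficients in terms of `E` and `C`
  rw [eKW, eKT, hCC, levelTwo_idA hNne, levelTwo_idC hNne] at hmain
  refine hmain.trans (le_of_eq ?_)
  ring

/-! ### The explicit second-order covariance bound -/

/-- **THE SECOND-ORDER COVARIANCE BOUND, explicit.**  `N ≥ 3`, `‖B‖_op < 1/2`, `φ` bounded measurable `L`-Lipschitz (Frobenius) on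
`SU(N)`: `|∫ φ · N Re tr(gΔ) dν_B − ∫ φ dν_B ∫ N Re tr(gΔ) dν_B| ≤ K₂(N, ‖B‖_op) · L · ‖Δ‖_F` (see the module docstring for `K₂`).
[folklore] -/
theorem cov_linear_le_levelTwo_explicit (hN : 3 ≤ N) {B : Matrix (Fin N) (Fin N) ℂ} (hB : matrixOpNorm B < 1 / 2)
    (Δ : Matrix (Fin N) (Fin N) ℂ) (φ : SUN N → ℝ) {L : ℝ} (hφm : Measurable φ) (hφb : ∃ C, ∀ s, |φ s| ≤ C)
    (hL : 0 ≤ L) (hφL : ∀ a b, |φ a - φ b| ≤ L * suFrobDist a b) :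
    |∫ s, φ s * ((N : ℝ) * ((s : Matrix (Fin N) (Fin N) ℂ) * Δ).trace.re)
          ∂(haarProbability (SUN N)).tilted (fun g => (N : ℝ) * ((g : Matrix (Fin N) (Fin N) ℂ) * B).trace.re) -
        (∫ s, φ s ∂(haarProbability (SUN N)).tilted (fun g => (N : ℝ) * ((g : Matrix (Fin N) (Fin N) ℂ) * B).trace.re)) *
          ∫ s, (N : ℝ) * ((s : Matrix (Fin N) (Fin N) ℂ) * Δ).trace.re
            ∂(haarProbability (SUN N)).tilted (fun g => (N : ℝ) * ((g : Matrix (Fin N) (Fin N) ℂ) * B).trace.re)| ≤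
      (N : ℝ) ^ 2 / ((N : ℝ) ^ 2 - 1) *
        (1 + ((N : ℝ) ^ 2 / (2 * ((N : ℝ) ^ 2 - 4))) * matrixOpNorm B + 4 * ((N : ℝ) ^ 2 / ((N : ℝ) ^ 2 - 1)) * (((N : ℝ) ^ 2 / (2 * ((N : ℝ) ^ 2 - 4))) + 1 / 4) * matrixOpNorm B ^ 2
          + 2 * ((((N : ℝ) ^ 2 / (2 * ((N : ℝ) ^ 2 - 4))) + 1 / 4) / N) * (matrixOpNorm B / Real.sqrt (1 / 2 - matrixOpNorm B))
          + ((5 * ((N : ℝ) ^ 2 / (2 * ((N : ℝ) ^ 2 - 4))) + 1 / 4) * matrixOpNorm B ^ 2 + 2 * ((N : ℝ) ^ 2 / ((N : ℝ) ^ 2 - 1)) * (10 * ((N : ℝ) ^ 2 / (2 * ((N : ℝ) ^ 2 - 4))) + 1 / 2) * matrixOpNorm B ^ 3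
              + ((10 * ((N : ℝ) ^ 2 / (2 * ((N : ℝ) ^ 2 - 4))) + 1 / 2) / N) * (matrixOpNorm B ^ 2 / Real.sqrt (1 / 2 - matrixOpNorm B))) / (1 / 2 - matrixOpNorm B)) * L * frobNorm Δ := by
  have h2 : 2 ≤ N := by omega
  have h3 : (3 : ℝ) ≤ N := by exact_mod_cast hN
  have hNpos : (0 : ℝ) < N := by linarith
  have hN1 : (0 : ℝ) < (N : ℝ) ^ 2 - 1 := by nlinarith
  have hDC : (N : ℝ) / ((N : ℝ) - 1 / N) = (N : ℝ) ^ 2 / ((N : ℝ) ^ 2 - 1) := by field_simp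
  have hDm : 0 ≤ 2 * ((N : ℝ) / ((N : ℝ) - 1 / N)) := by rw [hDC]; exact mul_nonneg (by norm_num) (div_nonneg (by positivity) hN1.le)
  have hZ1 : Real.sqrt (∫ g, ‖((g : Matrix (Fin N) (Fin N) ℂ) * B).trace‖ ^ 2
      ∂(haarProbability (SUN N)).tilted (fun g => (N : ℝ) * ((g : Matrix (Fin N) (Fin N) ℂ) * B).trace.re)) ≤
      2 * ((N : ℝ) / ((N : ℝ) - 1 / N)) * (Real.sqrt N * matrixOpNorm B * frobNorm B)
        + frobNorm B / Real.sqrt ((N : ℝ) * (1 / 2 - matrixOpNorm B)) :=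
    (sqrt_integral_normSq_trace_le h2 hB B).trans (le_of_eq (by ring))
  have hZ2 : Real.sqrt (∫ g, ‖((g : Matrix (Fin N) (Fin N) ℂ) * Δ).trace‖ ^ 2
      ∂(haarProbability (SUN N)).tilted (fun g => (N : ℝ) * ((g : Matrix (Fin N) (Fin N) ℂ) * B).trace.re)) ≤
      2 * ((N : ℝ) / ((N : ℝ) - 1 / N)) * (Real.sqrt N * matrixOpNorm B * frobNorm Δ)
        + frobNorm Δ / Real.sqrt ((N : ℝ) * (1 / 2 - matrixOpNorm B)) :=
    (sqrt_integral_normSq_trace_le h2 hB Δ).trans (le_of_eq (by ring))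
  refine (levelTwo_algebra hN rfl rfl hDm rfl rfl rfl rfl (matrixOpNorm_nonneg B) hB (frobNorm_nonneg B) (frobNorm_nonneg Δ) hL
    (frobNorm_le_sqrt_mul_matrixOpNorm B) hZ1 hZ2 (sqrt_integral_Gam_upsi_le hN B Δ) (sqrt_integral_Gam_c3_le hN B Δ)
    (cov_linear_le_levelTwo hN hB Δ φ hφm hφb hL hφL)).trans (le_of_eq ?_)
  rw [hDC]
  ring

/-! ### Monotonicity and the modulus -/

/-- `K₂(N, ·)` is increasing on `[0, 1/2)`. [folklore] -/
theorem levelTwoBody_mono (hN : 3 ≤ N) {r R : ℝ} (hr : 0 ≤ r) (hrR : r ≤ R) (hR : R < 1 / 2) :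
    (N : ℝ) ^ 2 / ((N : ℝ) ^ 2 - 1) *
        (1 + ((N : ℝ) ^ 2 / (2 * ((N : ℝ) ^ 2 - 4))) * r + 4 * ((N : ℝ) ^ 2 / ((N : ℝ) ^ 2 - 1)) * (((N : ℝ) ^ 2 / (2 * ((N : ℝ) ^ 2 - 4))) + 1 / 4) * r ^ 2
          + 2 * ((((N : ℝ) ^ 2 / (2 * ((N : ℝ) ^ 2 - 4))) + 1 / 4) / N) * (r / Real.sqrt (1 / 2 - r))
          + ((5 * ((N : ℝ) ^ 2 / (2 * ((N : ℝ) ^ 2 - 4))) + 1 / 4) * r ^ 2 + 2 * ((N : ℝ) ^ 2 / ((N : ℝ) ^ 2 - 1)) * (10 * ((N : ℝ) ^ 2 / (2 * ((N : ℝ) ^ 2 - 4))) + 1 / 2) * r ^ 3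
              + ((10 * ((N : ℝ) ^ 2 / (2 * ((N : ℝ) ^ 2 - 4))) + 1 / 2) / N) * (r ^ 2 / Real.sqrt (1 / 2 - r))) / (1 / 2 - r)) ≤
      (N : ℝ) ^ 2 / ((N : ℝ) ^ 2 - 1) *
        (1 + ((N : ℝ) ^ 2 / (2 * ((N : ℝ) ^ 2 - 4))) * R + 4 * ((N : ℝ) ^ 2 / ((N : ℝ) ^ 2 - 1)) * (((N : ℝ) ^ 2 / (2 * ((N : ℝ) ^ 2 - 4))) + 1 / 4) * R ^ 2
          + 2 * ((((N : ℝ) ^ 2 / (2 * ((N : ℝ) ^ 2 - 4))) + 1 / 4) / N) * (R / Real.sqrt (1 / 2 - R))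
          + ((5 * ((N : ℝ) ^ 2 / (2 * ((N : ℝ) ^ 2 - 4))) + 1 / 4) * R ^ 2 + 2 * ((N : ℝ) ^ 2 / ((N : ℝ) ^ 2 - 1)) * (10 * ((N : ℝ) ^ 2 / (2 * ((N : ℝ) ^ 2 - 4))) + 1 / 2) * R ^ 3
              + ((10 * ((N : ℝ) ^ 2 / (2 * ((N : ℝ) ^ 2 - 4))) + 1 / 2) / N) * (R ^ 2 / Real.sqrt (1 / 2 - R))) / (1 / 2 - R)) := by
  have h3 : (3 : ℝ) ≤ N := by exact_mod_cast hN
  have hN4 : (0 : ℝ) < (N : ℝ) ^ 2 - 4 := by nlinarith only [h3]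
  have hN1 : (0 : ℝ) < (N : ℝ) ^ 2 - 1 := by nlinarith only [h3]
  have hNpos : (0 : ℝ) < N := by linarith only [h3]
  set C : ℝ := (N : ℝ) ^ 2 / ((N : ℝ) ^ 2 - 1) with hCdef
  set E : ℝ := (N : ℝ) ^ 2 / (2 * ((N : ℝ) ^ 2 - 4)) with hE
  have hC0 : 0 ≤ C := div_nonneg (by positivity) hN1.le
  have hE0 : 0 ≤ E := by positivity
  have hR0 : 0 ≤ R := hr.trans hrR
  have h1 : 0 < 1 / 2 - R := by linarith only [hR]
  have h2 : 0 < 1 / 2 - r := by linarith only [hrR, hR]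
  have hsR : 0 < Real.sqrt (1 / 2 - R) := Real.sqrt_pos.2 h1
  have hsle : Real.sqrt (1 / 2 - R) ≤ Real.sqrt (1 / 2 - r) := Real.sqrt_le_sqrt (by linarith only [hrR])
  have p2 : r ^ 2 ≤ R ^ 2 := pow_le_pow_left₀ hr hrR 2
  have p3 : r ^ 3 ≤ R ^ 3 := pow_le_pow_left₀ hr hrR 3
  have q1 : r / Real.sqrt (1 / 2 - r) ≤ R / Real.sqrt (1 / 2 - R) := div_le_div₀ hR0 hrR hsR hsle
  have q2 : r ^ 2 / Real.sqrt (1 / 2 - r) ≤ R ^ 2 / Real.sqrt (1 / 2 - R) := div_le_div₀ (by positivity) p2 hsR hsle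
  have hnum : (5 * E + 1 / 4) * r ^ 2 + 2 * C * (10 * E + 1 / 2) * r ^ 3 + ((10 * E + 1 / 2) / N) * (r ^ 2 / Real.sqrt (1 / 2 - r)) ≤
      (5 * E + 1 / 4) * R ^ 2 + 2 * C * (10 * E + 1 / 2) * R ^ 3 + ((10 * E + 1 / 2) / N) * (R ^ 2 / Real.sqrt (1 / 2 - R)) := by
    have a1 := mul_le_mul_of_nonneg_left p2 (by positivity : (0 : ℝ) ≤ 5 * E + 1 / 4)
    have a2 := mul_le_mul_of_nonneg_left p3 (by positivity : (0 : ℝ) ≤ 2 * C * (10 * E + 1 / 2))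
    have a3 := mul_le_mul_of_nonneg_left q2 (by positivity : (0 : ℝ) ≤ (10 * E + 1 / 2) / N)
    linarith only [a1, a2, a3]
  have hnum0 : 0 ≤ (5 * E + 1 / 4) * R ^ 2 + 2 * C * (10 * E + 1 / 2) * R ^ 3
      + ((10 * E + 1 / 2) / N) * (R ^ 2 / Real.sqrt (1 / 2 - R)) := by positivity
  have hfrac := div_le_div₀ hnum0 hnum h1 (by linarith only [hrR] : 1 / 2 - R ≤ 1 / 2 - r)
  have b1 := mul_le_mul_of_nonneg_left hrR hE0
  have b2 := mul_le_mul_of_nonneg_left p2 (by positivity : (0 : ℝ) ≤ 4 * C * (E + 1 / 4))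
  have b3 := mul_le_mul_of_nonneg_left q1 (by positivity : (0 : ℝ) ≤ 2 * ((E + 1 / 4) / N))
  exact mul_le_mul_of_nonneg_left (by linarith only [b1, b2, b3, hfrac]) hC0

/-- **THE LEVEL-TWO ONE-LINK KANTOROVICH–RUBINSTEIN MODULUS, EVERY `SU(N)`, `N ≥ 3`, HYPOTHESIS-FREE**: for `R < 1/2`,
`OneLinkKRModulus N R (K₂(N,R))` — on the operator-norm ball `‖B‖_op ≤ R`, `|ν_B(φ) − ν_{B'}(φ)| ≤ K₂ · L · ‖B − B'‖_F` for every
bounded measurable `L`-Lipschitz `φ`.  Second order of the Laplacian-eigenfunction (covariance) hierarchy: exact Casimir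
decomposition of the degree-2 remainder, Bakry–Émery only on the cubic remainder, `L²(ν_B)` bookkeeping of every gradient
(cell note `HOME/p2/ONE-LINK-HIERARCHY.md`).  Proof: `cov_linear_le_levelTwo_explicit` along the segment `B_t = B + t(B' − B)`
(convexity of the ball, `levelTwoBody_mono`) and the covariance form of the tilt-interpolation lemma
`abs_integral_tilted_add_sub_le_of_cov`. [cite: arXiv220412737, Lemma 4.1 and Rem. 1.3] -/
theorem oneLinkKRModulus_levelTwo (hN : 3 ≤ N) {R : ℝ} (hR : R < 1 / 2) :
    OneLinkKRModulus N R
      ((N : ℝ) ^ 2 / ((N : ℝ) ^ 2 - 1) *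
        (1 + ((N : ℝ) ^ 2 / (2 * ((N : ℝ) ^ 2 - 4))) * R + 4 * ((N : ℝ) ^ 2 / ((N : ℝ) ^ 2 - 1)) * (((N : ℝ) ^ 2 / (2 * ((N : ℝ) ^ 2 - 4))) + 1 / 4) * R ^ 2
          + 2 * ((((N : ℝ) ^ 2 / (2 * ((N : ℝ) ^ 2 - 4))) + 1 / 4) / N) * (R / Real.sqrt (1 / 2 - R))
          + ((5 * ((N : ℝ) ^ 2 / (2 * ((N : ℝ) ^ 2 - 4))) + 1 / 4) * R ^ 2 + 2 * ((N : ℝ) ^ 2 / ((N : ℝ) ^ 2 - 1)) * (10 * ((N : ℝ) ^ 2 / (2 * ((N : ℝ) ^ 2 - 4))) + 1 / 2) * R ^ 3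
              + ((10 * ((N : ℝ) ^ 2 / (2 * ((N : ℝ) ^ 2 - 4))) + 1 / 2) / N) * (R ^ 2 / Real.sqrt (1 / 2 - R))) / (1 / 2 - R))) := by
  classical
  intro B B' hB hB' φ L hφm hφb hL hφL
  have hN0 : N ≠ 0 := by omega
  have hNpos : (0 : ℝ) < N := Nat.cast_pos.2 (Nat.pos_of_ne_zero hN0)
  set f : SUN N → ℝ := fun g => (N : ℝ) * ((g : Matrix (Fin N) (Fin N) ℂ) * B).trace.re with hf
  set w : SUN N → ℝ := fun g => (N : ℝ) * ((g : Matrix (Fin N) (Fin N) ℂ) * (B' - B)).trace.re with hw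
  have hfw : (fun g : SUN N => (N : ℝ) * ((g : Matrix (Fin N) (Fin N) ℂ) * B').trace.re) = fun g => f g + w g := by
    funext g
    simp only [hf, hw, Matrix.mul_sub, trace_sub, Complex.sub_re]
    ring
  rw [hfw, abs_sub_comm]
  have hfm : Measurable f := (continuous_const.mul (continuous_re_trace_su_mul B)).measurable
  have hwm : Measurable w := (continuous_const.mul (continuous_re_trace_su_mul (B' - B))).measurable
  have hfb : ∃ C, ∀ s, |f s| ≤ C := ⟨(N : ℝ) * (Real.sqrt N * frobNorm B), fun s => by
    simp only [hf]
    rw [abs_mul, abs_of_nonneg hNpos.le]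
    exact mul_le_mul_of_nonneg_left (abs_re_trace_su_mul_le s B) hNpos.le⟩
  have hwb : ∀ s, |w s| ≤ (N : ℝ) * (Real.sqrt N * frobNorm (B' - B)) := fun s => by
    simp only [hw]
    rw [abs_mul, abs_of_nonneg hNpos.le]
    exact mul_le_mul_of_nonneg_left (abs_re_trace_su_mul_le s _) hNpos.le
  have key := abs_integral_tilted_add_sub_le_of_cov (μ := haarProbability (SUN N))
    (A := ((N : ℝ) ^ 2 / ((N : ℝ) ^ 2 - 1) *
        (1 + ((N : ℝ) ^ 2 / (2 * ((N : ℝ) ^ 2 - 4))) * R + 4 * ((N : ℝ) ^ 2 / ((N : ℝ) ^ 2 - 1)) * (((N : ℝ) ^ 2 / (2 * ((N : ℝ) ^ 2 - 4))) + 1 / 4) * R ^ 2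
          + 2 * ((((N : ℝ) ^ 2 / (2 * ((N : ℝ) ^ 2 - 4))) + 1 / 4) / N) * (R / Real.sqrt (1 / 2 - R))
          + ((5 * ((N : ℝ) ^ 2 / (2 * ((N : ℝ) ^ 2 - 4))) + 1 / 4) * R ^ 2 + 2 * ((N : ℝ) ^ 2 / ((N : ℝ) ^ 2 - 1)) * (10 * ((N : ℝ) ^ 2 / (2 * ((N : ℝ) ^ 2 - 4))) + 1 / 2) * R ^ 3
              + ((10 * ((N : ℝ) ^ 2 / (2 * ((N : ℝ) ^ 2 - 4))) + 1 / 2) / N) * (R ^ 2 / Real.sqrt (1 / 2 - R))) / (1 / 2 - R))) * L * frobNorm (B' - B))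
    hfm hfb hwm hwb hφm hφb ?_
  · rw [frobNorm_sub_comm] at key
    exact key
  · intro t ht
    set Bt : Matrix (Fin N) (Fin N) ℂ := B + (t : ℂ) • (B' - B) with hBt
    have hft : (fun u : SUN N => f u + t * w u) =
        fun g : SUN N => (N : ℝ) * ((g : Matrix (Fin N) (Fin N) ℂ) * Bt).trace.re := by
      funext g
      simp only [hf, hw, hBt, Matrix.mul_add, Matrix.mul_smul, trace_add, trace_smul, Complex.add_re, smul_eq_mul,
        Complex.re_ofReal_mul]
      ring
    have hBt_le : matrixOpNorm Bt ≤ R := by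
      have h1 : Bt = ((1 - t : ℝ) : ℂ) • B + ((t : ℝ) : ℂ) • B' := by
        rw [hBt]; push_cast; simp only [smul_sub, sub_smul, one_smul]; abel
      rw [h1]
      calc matrixOpNorm (((1 - t : ℝ) : ℂ) • B + ((t : ℝ) : ℂ) • B')
          ≤ matrixOpNorm (((1 - t : ℝ) : ℂ) • B) + matrixOpNorm (((t : ℝ) : ℂ) • B') := matrixOpNorm_add_le _ _
        _ = (1 - t) * matrixOpNorm B + t * matrixOpNorm B' := by
            rw [matrixOpNorm_smul, matrixOpNorm_smul, Complex.norm_real, Complex.norm_real, Real.norm_eq_abs,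
              Real.norm_eq_abs, abs_of_nonneg (by linarith [ht.2]), abs_of_nonneg ht.1]
        _ ≤ (1 - t) * R + t * R :=
            add_le_add (mul_le_mul_of_nonneg_left hB (by linarith [ht.2])) (mul_le_mul_of_nonneg_left hB' ht.1)
        _ = R := by ring
    have hBt_lt : matrixOpNorm Bt < 1 / 2 := lt_of_le_of_lt hBt_le hR
    have hcov := cov_linear_le_levelTwo_explicit hN hBt_lt (B' - B) φ hφm hφb hL hφL
    rw [← hft] at hcov
    refine hcov.trans ?_
    have hmono := levelTwoBody_mono hN (matrixOpNorm_nonneg Bt) hBt_le hR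
    exact mul_le_mul_of_nonneg_right (mul_le_mul_of_nonneg_right hmono hL) (frobNorm_nonneg _)

end Summit.Ventures.YMGap.OneLinkEigen
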